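import Literature.NumberTheory.LFunctions.Zhang2022.Section18MainOrderE
import Literature.NumberTheory.LFunctions.Zhang2022.SkeletonC232E

/-!
# Zhang (2022) §2 final step: Cauchy–Schwarz is TIGHT at the certified main-order data
# (the «endgame inequality» repair class — replace Cauchy's inequality, keep the three inputs — cannot close)

Trunk T-ANT (NumberTheory/LFunctions). Y. Zhang, *Discrete mean estimates and the Landau–Siegel zero*,
arXiv:2211.02515v1 [Zhang2022LandauSiegel] — an unrefereed manuscript under adjudication; **nothing in this file
asserts or denies its Theorems 1–2**, and nothing here is a claim about Landau–Siegel zeros: these are ARITHMETIC /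
linear-algebra corollaries of the tree's certified brackets. Cell landau-siegel, D-0124 LS RESCUE (2) repair
catalogue, device class «endgame inequality» (refuter seat ls-rescue-ref-1).

§2 p. 6 (held text p0006:L71–L81): "Proposition 2.5 follows from the inequalities (2.32) and (2.33) by Cauchy's
inequality (and Lemma 2.3)". At main order the step uses exactly three data — `Ξ₁ ≲ c₂₃₂𝔞𝔓` (a `Σ‖aᵢ‖²`),
`Ξ_J ≲ c₂₃₃𝔞𝔓` (a `Σ‖bᵢ‖²`) and `Ξ₁* ∼ (𝔡′+𝔡)𝔞𝔓` (a `Σ aᵢb̄ᵢ`, (10.17)) — and closes iff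
`√(c₂₃₂c₂₃₃) < |𝔡′+𝔡|` (`MainOrderContradiction`, refuted at the record constants:
`not_mainOrderContradiction_cD_record`). A natural repair proposal is to replace Cauchy's inequality by a sharper
one (Hölder, duality, …) while keeping the three evaluated inputs. This file records why that class is empty:

* `cs_data_realizable` — Cauchy–Schwarz is the ONLY universal relation among the three data: every triple
  `(x, y, z)` with `0 < x` and `‖z‖² ≤ x·y` is realised by a two-term family `a b : Fin 2 → ℂ` with
  `Σ‖aᵢ‖² = x`, `Σ‖bᵢ‖² = y`, `Σ aᵢ b̄ᵢ = z`.
* `record_data_cs_slack` — the certified data are CS-feasible with room: `‖𝔡′+𝔡‖² < c₂₃₂ᴱ(e1ppD, 𝔠₂ᶜ)·C₂₃₃`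
  (`dsum_normSq_bounds`: `< 28.0792`; `c232E_e1ppD_tol_bounds`, `C233_bounds`: product `> 140.9`).
* `record_data_realizable` — hence a two-term toy family meets all three certified evaluations EXACTLY.
* `no_endgame_inequality_at_record` — if a predicate `Closes x y z` fails on the data of EVERY finite family
  (i.e. `¬Closes` is a valid inequality of the kind that could replace Cauchy's), then it fails at the certified
  data too: no such replacement derives a contradiction from the same three inputs. `no_endgame_inequality` is
  the same at any CS-feasible triple (rows at other constants).

Scope (refuted-as-typed ≠ refuted-in-print): this kills inequalities valid for ALL finite families in the three
data only; an argument using MORE (ℓᵖ information, pointwise term bounds, arithmetic structure of the specific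
families of §§3–18) needs new node evaluations, i.e. a new INPUT, and is a different catalogue class.
The programme SEARCHES and TYPES; no claim about Landau–Siegel zeros, Theorems 1–2 of arXiv:2211.02515 or a
repaired Margin232 until a kernel theorem says so.
-/

noncomputable section

namespace Literature.NumberTheory.LFunctions.Zhang2022.EndgameCS

open Literature.NumberTheory.LFunctions.Zhang2022
open Literature.NumberTheory.LFunctions.Zhang2022.Skeleton
open scoped BigOperators ComplexConjugate


/-- (helper) Cauchy–Schwarz is tight: any `(x, y, z)` with `0 < x`, `‖z‖² ≤ x·y` is the data `(Σ‖aᵢ‖², Σ‖bᵢ‖², Σ aᵢb̄ᵢ)`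
of a two-term family (`a = (√x, 0)`, `b = (z̄/√x, √(y − ‖z‖²/x))`). [folklore] -/
private theorem cs_data_realizable {x y : ℝ} {z : ℂ} (hx : 0 < x) (hz : ‖z‖ ^ 2 ≤ x * y) :
    ∃ a b : Fin 2 → ℂ,
      (∑ i, ‖a i‖ ^ 2) = x ∧ (∑ i, ‖b i‖ ^ 2) = y ∧ (∑ i, a i * conj (b i)) = z := by
  have hsx : 0 < Real.sqrt x := Real.sqrt_pos.2 hx
  have hsx2 : Real.sqrt x ^ 2 = x := Real.sq_sqrt hx.le
  have hrest : 0 ≤ y - ‖z‖ ^ 2 / x := by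
    rw [sub_nonneg, div_le_iff₀ hx]; linarith
  refine ⟨![(Real.sqrt x : ℂ), 0], ![conj z / (Real.sqrt x : ℂ), (Real.sqrt (y - ‖z‖ ^ 2 / x) : ℂ)],
    ?_, ?_, ?_⟩
  · simp only [Fin.sum_univ_two, Matrix.cons_val_zero, Matrix.cons_val_one, norm_zero, Complex.norm_real, Real.norm_eq_abs, abs_of_pos hsx]
    rw [hsx2]; ring
  · simp only [Fin.sum_univ_two, Matrix.cons_val_zero, Matrix.cons_val_one, norm_div, Complex.norm_conj, Complex.norm_real, Real.norm_eq_abs, abs_of_pos hsx,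
      abs_of_nonneg (Real.sqrt_nonneg _)]
    rw [div_pow, hsx2, Real.sq_sqrt hrest]; ring
  · simp only [Fin.sum_univ_two, Matrix.cons_val_zero, Matrix.cons_val_one, map_div₀, Complex.conj_conj, Complex.conj_ofReal, zero_mul, add_zero]
    have hne : (Real.sqrt x : ℂ) ≠ 0 := by exact_mod_cast hsx.ne'
    field_simp

/-- The certified (A)-world main-order data are CS-feasible with room: `‖𝔡′+𝔡‖² < c₂₃₂ᴱ(e1ppD, 𝔠₂ᶜ)·C₂₃₃`
(`28.0792 ≤ 0.055348 · 2546.8476`). [cite: Zhang2022LandauSiegel, §2 (2.32)–(2.33), §10 (10.17)] -/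
theorem record_data_cs_slack :
    ‖dprime + dfrak‖ ^ 2 < c232E e1ppD frakc2c.re * C233 := by
  have h1 := c232E_e1ppD_tol_bounds
  have h2 := C233_bounds
  have h3 := dsum_normSq_bounds
  rw [← Complex.normSq_eq_norm_sq, c232E_eq]
  nlinarith [h1.1, h2.1, h3.2]

/-- A two-term toy family meets the three certified main-order evaluations `(c₂₃₂ᴱ, C₂₃₃, 𝔡′+𝔡)` EXACTLY.
[cite: Zhang2022LandauSiegel, §2 (2.32)–(2.33), §10 (10.17)] -/
theorem record_data_realizable :
    ∃ a b : Fin 2 → ℂ, (∑ i, ‖a i‖ ^ 2) = c232E e1ppD frakc2c.re ∧ (∑ i, ‖b i‖ ^ 2) = C233 ∧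
      (∑ i, a i * conj (b i)) = dprime + dfrak :=
  cs_data_realizable (by rw [c232E_eq]; linarith [c232E_e1ppD_tol_bounds.1]) record_data_cs_slack.le

/-- **No endgame inequality on the same three inputs.** If `Closes x y z` is refuted by the data of every finite
family (`x = Σ‖aᵢ‖²`, `y = Σ‖bᵢ‖²`, `z = Σ aᵢb̄ᵢ`) — i.e. `¬Closes` is a valid inequality of the kind that could
replace Cauchy's at the §2 final step — then it does not hold at the certified data `(c₂₃₂ᴱ, C₂₃₃, 𝔡′+𝔡)` either.
[cite: Zhang2022LandauSiegel, §2 p. 6 (Prop. 2.5 from (2.32)–(2.33) by Cauchy's inequality)] -/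
theorem no_endgame_inequality_at_record (Closes : ℝ → ℝ → ℂ → Prop)
    (valid : ∀ (n : ℕ) (a b : Fin n → ℂ),
      ¬ Closes (∑ i, ‖a i‖ ^ 2) (∑ i, ‖b i‖ ^ 2) (∑ i, a i * conj (b i))) :
    ¬ Closes (c232E e1ppD frakc2c.re) C233 (dprime + dfrak) := by
  obtain ⟨a, b, ha, hb, hab⟩ := record_data_realizable
  rw [← ha, ← hb, ← hab]
  exact valid 2 a b

/-- The same at ANY CS-feasible data triple (catalogue rows at other constants).
[cite: Zhang2022LandauSiegel, §2 p. 6 (Prop. 2.5 from (2.32)–(2.33) by Cauchy's inequality)] -/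
theorem no_endgame_inequality {x y : ℝ} {z : ℂ} (hx : 0 < x) (hz : ‖z‖ ^ 2 ≤ x * y)
    (Closes : ℝ → ℝ → ℂ → Prop)
    (valid : ∀ (n : ℕ) (a b : Fin n → ℂ),
      ¬ Closes (∑ i, ‖a i‖ ^ 2) (∑ i, ‖b i‖ ^ 2) (∑ i, a i * conj (b i))) :
    ¬ Closes x y z := by
  obtain ⟨a, b, ha, hb, hab⟩ := cs_data_realizable hx hz
  rw [← ha, ← hb, ← hab]
  exact valid 2 a b

end Literature.NumberTheory.LFunctions.Zhang2022.EndgameCS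

end
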